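import Literature.NumberTheory.GaloisRepresentations.SerreProp14GL2Fp
import Literature.NumberTheory.GaloisRepresentations.SerreSubgroupsGL2FpPrimeToP
import Literature.NumberTheory.GaloisRepresentations.SerreOpenImageGroupLemmas
import Literature.NumberTheory.GaloisRepresentations.SerreProp16PGL2Cor
import HarnessLib

/-!
# Route `SmallImageMuTransfer` (rung K6, leaf `BSDpOnClassX9`), crux `AnalyticMuZeroX9NoCMPartner`:
# Serre's exceptional subgroups of `GL₂(𝔽_p)` containing a split half-Cartan subgroup —
# `p = 5` and projective image `𝔖₄` (KERNEL; the group theory behind "type `5S4`")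

HONEST FRAMING (cell `b2b-bsdres`, X9 prover lineage; verbatim): the cell deletes COMBINATION-SHAPED
residual classes of the rank-≤1 BSD formula from PUBLISHED theorems only and TYPES the
construction-shaped remainder; this is not "finishing BSD".  Nothing below asserts anything about
any curve; it is finite group theory over `GL₂(𝔽_p)` in the tree's Serre-1972 vocabulary
(`GaloisRepresentations/SerreCartanSubgroupsGL2Fp`: `halfSplitCartan`, `splitCartan`,
`cartanSubgroups`, `unitGroup (adjoinElem y)`; `ProjectiveType`: `eigenvectorStabilizer`; Mathlib
`Matrix.ProjGenLinGroup` = `PGL₂`).  Helper file for the statement item `AnalyticMuZeroX9NoCMPartner`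
(stmt-BirchSwinnertonDyer-19235; `--supports … --as helper`): it closes no stub and no item; its
class-level consumer is `SmallImageMuTransferAnalyticMuZeroX9NoCMPartnerExceptionalS4.lean`.

J.-P. Serre, Invent. Math. 15 (1972), §2.7, after Prop. 17: the hypothesis "`p ≠ 5` si `C` est
déployé" is needed because at `p = 5` a subgroup containing a split half-Cartan subgroup (cyclic of
order `4`) may have projective image `𝔖₄ ⊂ PGL₂(𝔽₅) ≅ 𝔖₅`.  This file proves the converse
bookkeeping, which is what the X9 line needs:

* `ExceptionalS4.eq_five_and_nonempty_mulEquiv_perm` — let `p ≥ 5` and `G ≤ GL₂(𝔽_p)` have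
  order prime to `p`, contain a split half-Cartan subgroup `P (1 0; 0 *) P⁻¹`, fix no line of
  `𝔽_p²`, and lie inside every split Cartan subgroup it normalises.  Then `p = 5` and the image
  `Ḡ` of `G` in `PGL₂(𝔽_p)` is `≃* 𝔖₄` (Mathlib `Equiv.Perm (Fin 4)`).  Proof: `G` normalises NO
  Cartan subgroup (Prop. 14, `eq_splitCartan_of_halfSplitCartan_le_normalizer`, pins a normalised
  Cartan to `P (* 0; 0 *) P⁻¹`, inside which `G` would fix the line `𝔽_p · P e₀`); so by n° 2.6
  (`Serre1972.comm_or_exists_card_le_or_card_eq`; abelian ⇒ inside the Cartan subgroup `𝔽_p[y]ˣ`,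
  normal maximal torus ⇒ `le_normalizer_unitGroup_adjoinElem`) `[G : Z] ∈ {12, 24, 60}` and
  `[C_G(x) : Z] ≤ 5` for `x ∉ Z`; the projection `G → PGL₂(𝔽_p)` has kernel exactly `Z = Z(G)`
  (the scalars of the non-abelian `G`, `DeligneSerre1974.exists_mat_eq_smul_one_of_mem_center`), so
  `|Ḡ| = [G : Z]` and every element of `Ḡ` has order `≤ 5`
  (`orderOf_apply_le_of_card_centralizer_le` — "les éléments de `H` sont alors d'ordre `1, 2, 3, 4`
  ou `5`"); the image of `y = P diag(1, u) P⁻¹`, `u` a generator of `𝔽_pˣ`, has order `p - 1`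
  (`orderOf_mk_conj_halfDiagonalHom`), whence `p = 5` and `|Ḡ| ∈ {12, 24}` (`5 ∤ |G|`); finally
  Prop. 16 (`Serre1972.prop16_card`, Dickson's list): cyclic `Ḡ` or `Ḡ ≃ D_m` (`2m = |Ḡ|`) would
  contain an element of order `≥ 6`, `𝔄₄` has no element of order `4`
  (`orderOf_le_three_of_mem_alternatingGroup`, the twelve even permutations checked by `decide`),
  `𝔄₅` has order `60`; so `Ḡ ≃* 𝔖₄`.
* Small tools: `mk_ne_one_of_ne_smul_one` / `mk_eq_one_of_eq_smul_one` (scalars = kernel of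
  `GL₂ → PGL₂`), `injective_mk_conj_halfDiagonalHom` (a split half-Cartan subgroup embeds in
  `PGL₂`), `card_map_mul_card_ker` (`|f(C)| · |ker f| = |C|` for `C ⊇ ker f`).

No definition, no named fact, no `sorry`; axioms standard.  (X9 prover GEN 40, 2026-08-26.)

## References

* [Serre1972] J.-P. Serre, *Propriétés galoisiennes des points d'ordre fini des courbes
  elliptiques*, Invent. Math. 15 (1972) 259–331: §2.2 Prop. 14; §2.5 Prop. 16; §2.6; §2.7
  Prop. 17 and the remark on `p = 5`.
-/

-- the summit and its single problem are both named `BirchSwinnertonDyer` (registry layout D-0017)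
set_option linter.dupNamespace false

set_option autoImplicit false

noncomputable section

open scoped Classical MatrixGroups
open Matrix
open Literature.NumberTheory.GaloisRepresentations
  Literature.NumberTheory.GaloisRepresentations.Serre1972

namespace Summit.BirchSwinnertonDyer.BirchSwinnertonDyer.Rank1Residual

namespace ExceptionalS4

/-! ### Scalars and the projective line group -/

section Field

variable {F : Type*} [Field F]

/-- A non-scalar element of `GL₂(F)` has non-trivial image in `PGL₂(F)` (the centre of `GL₂(F)`
is the group of scalars, Mathlib `Matrix.GeneralLinearGroup.center_eq_range_scalar`). [folklore] -/
theorem mk_ne_one_of_ne_smul_one {g : GL (Fin 2) F}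
    (hg : ∀ c : F, (g : Matrix (Fin 2) (Fin 2) F) ≠ c • 1) :
    Matrix.ProjGenLinGroup.mk g ≠ 1 := by
  intro h1
  rw [Matrix.ProjGenLinGroup.mk_eq_one, Matrix.GeneralLinearGroup.center_eq_range_scalar] at h1
  obtain ⟨u, hu⟩ := h1
  apply hg (u : F)
  rw [← hu, Matrix.GeneralLinearGroup.coe_scalar, Matrix.scalar_apply, Matrix.smul_one_eq_diagonal]

/-- A scalar element of `GL₂(F)` has trivial image in `PGL₂(F)`. [folklore] -/
theorem mk_eq_one_of_eq_smul_one {g : GL (Fin 2) F} {c : F}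
    (hg : (g : Matrix (Fin 2) (Fin 2) F) = c • 1) :
    Matrix.ProjGenLinGroup.mk g = 1 := by
  have hc0 : c ≠ 0 := by
    rintro rfl
    apply GL2.det_ne_zero g
    rw [hg, zero_smul, Matrix.det_zero]
  rw [Matrix.ProjGenLinGroup.mk_eq_one, Matrix.GeneralLinearGroup.center_eq_range_scalar]
  refine ⟨Units.mk0 c hc0, Units.ext ?_⟩
  rw [Matrix.GeneralLinearGroup.coe_scalar, Matrix.scalar_apply, hg, Units.val_mk0,
    Matrix.smul_one_eq_diagonal]

/-- **The image of a split half-Cartan subgroup in `PGL₂(F)` is a copy of `Fˣ`**: the element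
`P diag(1, u) P⁻¹` is scalar only for `u = 1`, so `u ↦ \overline{P diag(1, u) P⁻¹}` is injective.
[folklore] -/
theorem injective_mk_conj_halfDiagonalHom (P : GL (Fin 2) F) :
    Function.Injective
      (Matrix.ProjGenLinGroup.mk.comp ((MulAut.conj P).toMonoidHom.comp halfDiagonalHom) :
        Fˣ →* PGL(Fin 2, F)) := by
  rw [injective_iff_map_eq_one]
  intro u hu
  by_contra hu1
  exact mk_ne_one_of_ne_smul_one (conj_halfDiagonalHom_ne_smul_one P hu1) hu

/-- Hence `\overline{P diag(1, u) P⁻¹}` has the order of `u` in `Fˣ`. [folklore] -/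
theorem orderOf_mk_conj_halfDiagonalHom (P : GL (Fin 2) F) (u : Fˣ) :
    orderOf (Matrix.ProjGenLinGroup.mk ((MulAut.conj P).toMonoidHom (halfDiagonalHom u))) =
      orderOf u :=
  orderOf_injective _ (injective_mk_conj_halfDiagonalHom P) u

end Field

/-! ### From Serre's torus bound to a bound on projective orders -/

section Torus

variable {A Q : Type*} [Group A] [Group Q]

/-- For a subgroup `C` containing `ker f`: `|f(C)| · |ker f| = |C|`. [folklore] -/
theorem card_map_mul_card_ker (f : A →* Q) {C : Subgroup A} (hC : f.ker ≤ C) :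
    Nat.card (C.map f) * Nat.card f.ker = Nat.card C := by
  have e1 := Subgroup.card_eq_card_quotient_mul_card_subgroup ((f.restrict C).ker)
  have e2 : Nat.card (C ⧸ (f.restrict C).ker) = Nat.card (C.map f) := by
    rw [← MonoidHom.restrict_range C f]
    exact Nat.card_congr (QuotientGroup.quotientKerEquivRange (f.restrict C)).toEquiv
  have e3 : Nat.card (f.restrict C).ker = Nat.card f.ker := by
    rw [MonoidHom.ker_restrict]
    exact Nat.card_congr (Subgroup.subgroupOfEquivOfLe hC).toEquiv
  rw [e1, e2, e3]

/-- **Serre 1972, §2.6 iii): "les éléments de `H` sont alors d'ordre `1, 2, 3, 4` ou `5`".**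
If `f : A → Q` has kernel exactly the centre `Z` of `A` and every centraliser `C_A(x)`, `x ∉ Z`,
has `|C_A(x)| ≤ n |Z|` (`n ≥ 1`), then every `f(x)` has order `≤ n`: the cyclic group generated by
`f(x)` lies in `f(C_A(x))`, of order `[C_A(x) : Z] ≤ n`. [cite: Serre1972, §2.6] -/
theorem orderOf_apply_le_of_card_centralizer_le [Finite A] [Finite Q] (f : A →* Q)
    (hker : f.ker = Subgroup.center A)
    {n : ℕ} (hn : 1 ≤ n)
    (htori : ∀ x : A, x ∉ Subgroup.center A →
      Nat.card (Subgroup.centralizer ({x} : Set A)) ≤ n * Nat.card (Subgroup.center A))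
    (x : A) : orderOf (f x) ≤ n := by
  by_cases hx : x ∈ Subgroup.center A
  · have h1 : f x = 1 := by rw [← MonoidHom.mem_ker, hker]; exact hx
    rw [h1, orderOf_one]
    exact hn
  · set C : Subgroup A := Subgroup.centralizer ({x} : Set A) with hCdef
    have hZC : f.ker ≤ C := by rw [hker]; exact Subgroup.center_le_centralizer _
    have hcard := card_map_mul_card_ker f hZC
    have hZpos : 0 < Nat.card f.ker := Nat.card_pos
    have hle : Nat.card (C.map f) ≤ n := by
      have h := htori x hx
      rw [← hcard, ← hker] at h
      exact Nat.le_of_mul_le_mul_right h hZpos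
    have hmem : f x ∈ C.map f :=
      Subgroup.mem_map.mpr ⟨x, Subgroup.mem_centralizer_singleton_iff.mpr rfl, rfl⟩
    exact (Nat.le_of_dvd Nat.card_pos (Subgroup.orderOf_dvd_natCard _ hmem)).trans hle

end Torus

/-! ### The alternating group `𝔄₄` has no element of order `4` -/

/-- The elements of `𝔄₄` have order `≤ 3` (`σ² = 1` or `σ³ = 1` for each of the twelve even
permutations of `Fin 4`). [folklore] -/
theorem orderOf_le_three_of_mem_alternatingGroup {σ : Equiv.Perm (Fin 4)}
    (hσ : σ ∈ alternatingGroup (Fin 4)) : orderOf σ ≤ 3 := by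
  have key : ∀ τ : Equiv.Perm (Fin 4), Equiv.Perm.sign τ = 1 → τ ^ 2 = 1 ∨ τ ^ 3 = 1 := by
    set_option maxRecDepth 8000 in decide
  rcases key σ (Equiv.Perm.mem_alternatingGroup.mp hσ) with h | h
  · exact (orderOf_le_of_pow_eq_one (by norm_num) h).trans (by norm_num)
  · exact orderOf_le_of_pow_eq_one (by norm_num) h


/-! ### Serre's exceptional case: `p = 5` and projective image `𝔖₄` -/

section Prime

variable {p : ℕ} [Fact p.Prime]

/-- **The exceptional subgroups of `GL₂(𝔽_p)` containing a split half-Cartan subgroup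
(Serre 1972, §2.7, the case `p = 5` excepted from Prop. 17, with §2.6 and Prop. 16).**  Let
`p ≥ 5` and let `G ⊆ GL₂(𝔽_p)` be a subgroup of order prime to `p` which contains a split
half-Cartan subgroup `P (1 0; 0 *) P⁻¹`, fixes no line of `𝔽_p²`, and is such that whenever `G`
normalises a split Cartan subgroup it lies inside it.  Then `p = 5` and the image of `G` in
`PGL₂(𝔽_p)` is isomorphic to `𝔖₄`.  Proof.  `G` normalises NO Cartan subgroup `C`: Prop. 14
(`eq_splitCartan_of_halfSplitCartan_le_normalizer`) would make `C = P (* 0; 0 *) P⁻¹`, then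
`G ⊆ C` by hypothesis and `G` fixes the line `𝔽_p · P e₀`.  Hence (§2.6,
`comm_or_exists_card_le_or_card_eq`) `G` is neither abelian (it would lie in the Cartan subgroup
`𝔽_p[y]ˣ` of `y = P diag(1, u) P⁻¹`, `u` a generator of `𝔽_pˣ`) nor has a normal maximal torus
(`le_normalizer_unitGroup_adjoinElem`), so `[G : Z] ∈ {12, 24, 60}` and every `C_G(x)`, `x ∉ Z`,
has `[C_G(x) : Z] ≤ 5`; the projection `G → PGL₂(𝔽_p)` has kernel `Z = Z(G)` (the scalars of
`G`), so its image `H` has order `[G : Z]` and all its elements have order `≤ 5`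
(`orderOf_apply_le_of_card_centralizer_le`).  The image of `y` has order `p - 1`, whence
`p = 5`, and `|H| ∈ {12, 24}` (`5 ∤ |G|`).  By Prop. 16 (`prop16_card`) `H` is cyclic — no: it
would have an element of order `|H| > 5` —, dihedral `D_m` with `2m = |H|` — no: `r` has order
`m ≥ 6` —, `𝔄₄` — no: `ȳ` has order `4` — , or `𝔖₄`.
[cite: Serre1972, §2.7, Prop. 17 and the remark on `p = 5`; §2.6; §2.5 Prop. 16; §2.2 Prop. 14] -/
theorem eq_five_and_nonempty_mulEquiv_perm (h5 : 5 ≤ p)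
    (G : Subgroup (GL (Fin 2) (ZMod p))) (hpG : ¬ p ∣ Nat.card G)
    {P : GL (Fin 2) (ZMod p)} (hHG : halfSplitCartan P ≤ G)
    (hirr : ∀ (v : Fin 2 → ZMod p) (hv : v ≠ 0), ¬ G ≤ eigenvectorStabilizer v hv)
    (hexc : ¬ ∃ P' : GL (Fin 2) (ZMod p),
      G ≤ Subgroup.normalizer (splitCartan P' : Set (GL (Fin 2) (ZMod p))) ∧
        ¬ G ≤ splitCartan P') :
    p = 5 ∧ Nonempty (G.map Matrix.ProjGenLinGroup.mk ≃* Equiv.Perm (Fin 4)) := by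
  classical
  have hp : p.Prime := Fact.out
  have hp2 : p ≠ 2 := by omega
  haveI : NeZero p := ⟨hp.ne_zero⟩
  haveI : Finite (PGL(Fin 2, ZMod p)) :=
    Finite.of_surjective _ Matrix.ProjGenLinGroup.mk_surjective
  have htwo : (2 : ZMod p) ≠ 0 := DeligneSerre1974.two_ne_zero_of_ne_two hp2
  -- (0) `G` normalises no Cartan subgroup
  have hnoCartan : ∀ C ∈ cartanSubgroups (ZMod p),
      ¬ G ≤ Subgroup.normalizer (C : Set (GL (Fin 2) (ZMod p))) := by
    intro C hC hGN
    have hCP : C = splitCartan P :=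
      eq_splitCartan_of_halfSplitCartan_le_normalizer hC h5 (hHG.trans hGN)
    subst hCP
    have hGC : G ≤ splitCartan P := by
      by_contra hGC
      exact hexc ⟨P, hGN, hGC⟩
    exact hirr _ (col_ne_zero P 0) (hGC.trans (splitCartan_le_eigenvectorStabilizer P))
  -- (1) the element `y = P diag(1, u) P⁻¹ ∈ G`, `u` a generator of `𝔽_pˣ`
  obtain ⟨u, hu⟩ := IsCyclic.exists_ofOrder_eq_natCard (α := (ZMod p)ˣ)
  have hcardu : Nat.card (ZMod p)ˣ = p - 1 := by
    rw [Nat.card_eq_fintype_card, ZMod.card_units]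
  rw [hcardu] at hu
  have hu1 : u ≠ 1 := by
    intro h1
    rw [h1, orderOf_one] at hu
    omega
  set y : GL (Fin 2) (ZMod p) := (MulAut.conj P).toMonoidHom (halfDiagonalHom u) with hy
  have hyG : y ∈ G :=
    hHG ⟨halfDiagonalHom u, by rw [← range_halfDiagonalHom]; exact ⟨u, rfl⟩, rfl⟩
  have hys : ∀ c : ZMod p, (y : Matrix (Fin 2) (Fin 2) (ZMod p)) ≠ c • 1 :=
    conj_halfDiagonalHom_ne_smul_one P hu1
  -- (2) `G` is not abelian: otherwise `G ⊆ 𝔽_p[y]ˣ`, a Cartan subgroup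
  have hab : ¬ ∀ a b : G, a * b = b * a := by
    intro hab
    have hdisc : (y : Matrix (Fin 2) (Fin 2) (ZMod p)).trace ^ 2 -
        4 * (y : Matrix (Fin 2) (Fin 2) (ZMod p)).det ≠ 0 :=
      DeligneSerre1974.TwoByTwo.disc_ne_zero_of_pow_eq_one htwo hys
        (DeligneSerre1974.det_mat_ne_zero (⟨y, hyG⟩ : G)) (m := Nat.card G)
        (by rwa [Ne, ZMod.natCast_eq_zero_iff])
        (by
          have h1 : ((⟨y, hyG⟩ : G) ^ Nat.card G) = 1 := pow_card_eq_one'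
          have h2 : y ^ Nat.card G = 1 := by
            have h3 := congrArg Subtype.val h1
            rwa [Subgroup.coe_pow, Subgroup.coe_one] at h3
          rw [← Units.val_pow_eq_pow_val, h2, Units.val_one])
    exact hnoCartan _ (unitGroup_adjoinElem_mem_cartanSubgroups hys hdisc)
      ((le_unitGroup_adjoinElem_of_comm hab (y := ⟨y, hyG⟩) hys).trans Subgroup.le_normalizer)
  -- (3) n° 2.6: no normal maximal torus either, so `[G : Z] ∈ {12, 24, 60}` with small tori
  obtain ⟨hcardG, htori⟩ : (Nat.card G = 12 * Nat.card (Subgroup.center G) ∨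
        Nat.card G = 24 * Nat.card (Subgroup.center G) ∨
        Nat.card G = 60 * Nat.card (Subgroup.center G)) ∧
      ∀ x : G, x ∉ Subgroup.center G →
        Nat.card (Subgroup.centralizer ({x} : Set G)) ≤ 5 * Nat.card (Subgroup.center G) := by
    rcases comm_or_exists_card_le_or_card_eq G hp2 hpG with hab' | ⟨x, hx, hxcard⟩ | h
    · exact absurd hab' hab
    · exfalso
      have hT := normal_centralizer_of_card_le_two_mul hxcard
      obtain ⟨hxs, hdisc⟩ := DeligneSerre1974.nonscalar_of_not_mem_center htwo hpG hx
      exact hnoCartan _ (unitGroup_adjoinElem_mem_cartanSubgroups hxs hdisc)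
        (le_normalizer_unitGroup_adjoinElem hxs hT)
    · exact h
  -- (4) the projection `f : G → PGL₂(𝔽_p)`: image `PG`, kernel `Z(G)`
  set PG : Subgroup (PGL(Fin 2, ZMod p)) := G.map Matrix.ProjGenLinGroup.mk with hPGdef
  set f : G →* PGL(Fin 2, ZMod p) := Matrix.ProjGenLinGroup.mk.comp G.subtype with hf
  have hfapply : ∀ x : G, f x = Matrix.ProjGenLinGroup.mk (x : GL (Fin 2) (ZMod p)) := by
    intro x
    rw [hf, MonoidHom.comp_apply, Subgroup.coe_subtype]
  have hfrange : f.range = PG := by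
    rw [hf, MonoidHom.range_comp, Subgroup.range_subtype]
  have hker : f.ker = Subgroup.center G := by
    ext g
    rw [MonoidHom.mem_ker, hfapply]
    constructor
    · intro hg
      by_contra hgZ
      exact mk_ne_one_of_ne_smul_one (DeligneSerre1974.nonscalar_of_not_mem_center htwo hpG hgZ).1 hg
    · intro hg
      obtain ⟨c, hc⟩ := DeligneSerre1974.exists_mat_eq_smul_one_of_mem_center hab hg
      exact mk_eq_one_of_eq_smul_one hc
  have hmemPG : ∀ x : G, f x ∈ PG := fun x ↦ by rw [← hfrange]; exact ⟨x, rfl⟩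
  have hliftPG : ∀ g : PG, ∃ x : G, f x = (g : PGL(Fin 2, ZMod p)) := fun g ↦ by
    have hg : (g : PGL(Fin 2, ZMod p)) ∈ f.range := by rw [hfrange]; exact g.2
    exact hg
  have hcardPG : Nat.card PG * Nat.card (Subgroup.center G) = Nat.card G := by
    have h := card_map_mul_card_ker f (C := ⊤) le_top
    rwa [← MonoidHom.range_eq_map, Subgroup.card_top, hfrange, hker] at h
  -- (5) every element of `PG` has order `≤ 5`; the image of `y` has order `p - 1`; so `p = 5`
  have hord5 : ∀ x : G, orderOf (f x) ≤ 5 :=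
    orderOf_apply_le_of_card_centralizer_le f hker (by norm_num) htori
  have hyord : orderOf (f ⟨y, hyG⟩) = p - 1 := by
    rw [hfapply, ← hu]
    exact orderOf_mk_conj_halfDiagonalHom P u
  have hp5 : p = 5 := by
    have h := hord5 ⟨y, hyG⟩
    rw [hyord] at h
    rcases (by omega : p = 5 ∨ p = 6) with h' | h'
    · exact h'
    · exfalso
      subst h'
      exact absurd hp (by decide)
  refine ⟨hp5, ?_⟩
  -- (6) `|PG| ∈ {12, 24}` and Prop. 16
  have hZpos : 0 < Nat.card (Subgroup.center G) := Nat.card_pos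
  have hPG : Nat.card PG = 12 ∨ Nat.card PG = 24 := by
    rcases hcardG with h | h | h
    · left
      rw [h] at hcardPG
      exact Nat.eq_of_mul_eq_mul_right hZpos hcardPG
    · right
      rw [h] at hcardPG
      exact Nat.eq_of_mul_eq_mul_right hZpos hcardPG
    · exfalso
      apply hpG
      rw [h]
      have h60 : p ∣ 60 := by rw [hp5]; norm_num
      exact dvd_mul_of_dvd_left h60 _
  have hPG0 : ((Nat.card PG : ℕ) : ZMod p) ≠ 0 := by
    rw [Ne, ZMod.natCast_eq_zero_iff]
    intro hdvd
    rcases hPG with h | h <;> rw [h, hp5] at hdvd <;> norm_num at hdvd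
  rcases prop16_card PG hPG0 with hcyc | ⟨m, ⟨e⟩⟩ | ⟨-, ⟨e⟩⟩ | ⟨-, ⟨e⟩⟩ | ⟨h60, -⟩
  · -- cyclic: an element of order `|PG| ≥ 12 > 5`
    exfalso
    obtain ⟨g, hg⟩ := IsCyclic.exists_ofOrder_eq_natCard (α := PG)
    obtain ⟨x, hx⟩ := hliftPG g
    have h := hord5 x
    rw [hx, Subgroup.orderOf_coe, hg] at h
    omega
  · -- dihedral `D_m`, `2m = |PG| ≥ 12`: the rotation `r` has order `m ≥ 6 > 5`
    exfalso
    have hm : Nat.card PG = 2 * m := by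
      rw [Nat.card_congr e.toEquiv, DihedralGroup.nat_card]
    obtain ⟨x, hx⟩ := hliftPG (e.symm (DihedralGroup.r 1))
    have h := hord5 x
    rw [hx, Subgroup.orderOf_coe, MulEquiv.orderOf_eq, DihedralGroup.orderOf_r_one] at h
    omega
  · -- `𝔄₄`: the image of `y` has order `p - 1 = 4 > 3`
    exfalso
    have h1 : orderOf ((e ⟨f ⟨y, hyG⟩, hmemPG _⟩ : alternatingGroup (Fin 4)) :
        Equiv.Perm (Fin 4)) = p - 1 := by
      rw [Subgroup.orderOf_coe, MulEquiv.orderOf_eq, Subgroup.orderOf_mk, hyord]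
    have h3 := orderOf_le_three_of_mem_alternatingGroup (e ⟨f ⟨y, hyG⟩, hmemPG _⟩).2
    rw [h1] at h3
    omega
  · exact ⟨e⟩
  · exfalso
    rcases hPG with h | h <;> omega

end Prime

end ExceptionalS4

end Summit.BirchSwinnertonDyer.BirchSwinnertonDyer.Rank1Residual

end
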